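import Summits.BirchSwinnertonDyer.Rank1Residual.X11a.SelmerCompanionBound
import Summits.BirchSwinnertonDyer.Rank1Residual.X11a.Cells
import Literature.NumberTheory.EllipticCurves.BSDRankZeroDensityProofs
import Literature.NumberTheory.EllipticCurves.IwasawaLeadingTermProofs
import Literature.NumberTheory.EllipticCurves.BSDSelmerCMPConverseRankOneProofs
import Literature.NumberTheory.EllipticCurves.GreenbergVatsal2000.CongruentCurves
import Literature.NumberTheory.EllipticCurves.Rank1Residual.Typed.SelmerCardCertificate
import HarnessLib

/-!
# Route (3e) SELMER COMPANION, II: Cassels–Tate parity and the per-pair route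
# `BSD(A,p) ⟹ BSD(E,p)` through `Sel^(p)` alone (class X11a = N7; cell `b2b-bsdres`, unit
# `b2b-bsdres-x11a`, gen 26)

HONEST FRAMING (run/shared/lean/b2b/bsd-rank1-residual/, verbatim in every file): the goal of the
cell is to DELETE the COMBINATION-SHAPED residual classes of the Birch–Swinnerton-Dyer formula for
ALL analytic-rank `≤ 1` elliptic curves over `ℚ` — "full BSD formula for every rank `≤ 1` curve in
class `C`" assembled STRICTLY from published theorems — so that the rank-`≤ 1` remainder becomes
exactly the CONSTRUCTION-SHAPED classes, which are TYPED (missing-input `Prop`s), NOT attempted.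
This is not "finishing BSD". CLASS-OWNERS.md: research routes; NO CLAIM BEYOND STATED CLASSES.
THEOREMS ONLY (no definition, no named fact, no `sorry`). Every theorem is CONDITIONAL on the named
PUBLISHED facts in its binders (Gross–Zagier–Kolyvagin `hGZK`; the Cassels–Tate pairing `hCT`; Tate's
uniformisation `hU`, `hU2` where multiplicative places are compared) and on the per-pair finite
inputs it names. Nothing is booked by this file; no label moves; X11a stays COMBINATION-SHAPED.

## The route

For a rank-`0` pair `(E, p)` (`p` odd, `E[p]` irreducible, `p ∤ #Ш(E/ℚ)_an` — e.g. every pair of the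
non-surjective leaf of X11a at `p = 5`, and every X11a pair at `p = 3` with `3 ∤ #Ш_an`) and a
`p`-congruent partner `A` (`Γ_ℚ`-isomorphism `e : A[p] ≃ E[p]`, the Kraus–Oesterlé certificate C1):

1. `#Sel^(p)(E/ℚ) ≤ #Sel^(p)(A/ℚ) · ∏_{v ∈ T} #E(ℚ_v)[p] · #(ℤ_v/p)` whenever every bad place of
   `E` or `A` outside `T` is of one of the three kinds of
   `SelmerCompanion.natCard_selmerGroup_le_of_congr_of_places` (file I);
2. **parity** (`natCard_selmerGroup_eq_one_of_le`): for `E` of rank `0` with `E(ℚ)[p] = 0` and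
   `Ш(E)[p^∞]` finite, `#Sel^(p)(E/ℚ) = #Ш(E)[p] = p^{2m}` by the Cassels–Tate pairing
   (`exists_selmerRank_eq_add`), so `#Sel^(p)(E/ℚ) ≤ p` forces `Sel^(p)(E/ℚ) = 0`;
3. `Sel^(p)(E/ℚ) = 0` ⟹ `Ш(E/ℚ)[p] = 0` ⟹ `BSD(E,p)` (`bsdp_of_card_selmerGroup_eq_pow_analyticRank`,
   Miller's last clause with both sides of valuation `0`);
4. the partner's count **`#Sel^(p)(A/ℚ) = p^{r_an(A)}`** from `BSD(A,p)`, `p ∤ #Ш(A/ℚ)_an` and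
   `A[p]` irreducible (`natCard_selmerGroup_eq_pow_of_bsdp`; irreducibility is transported along
   `e`), so the budget is `p^{r_an(A)} · ∏_{v ∈ T} (…) ≤ p`: a rank-`0` partner leaves room for ONE
   lossy place of cost `p` (e.g. `p` itself when `E` is non-split multiplicative and `A` good at
   `p`: `#E(ℚ_p)[p] · #(ℤ_p/p) = 1 · p`), a rank-`1` partner for none.

Consumers: `bsdp_of_natCard_selmerGroup_le` (steps 2–3), `bsdp_of_selmerCompanion` (1–3; partner
datum `#Sel^(p)(A/ℚ)`), **`bsdp_of_bsdp_partner_of_selmerCompanion`** (1–4: `BSD(A,p) ⟹ BSD(E,p)`,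
the booking shape) and its X11a form `bsdp_of_bsdp_partner_of_selmerCompanion_of_classX11a`.
Compared with routes (3a) CM partner / (3d) trivial partner (`X11a/CMPartner.lean`,
`X11a/TrivialPartner.lean`): NO main conjecture, NO `μ`-certificate, NO Emerton–Pollack–Weston (so no
`p ≥ 5`), NO Tamagawa / non-anomalous / `p`-adic `L`-value condition on the partner, whose rank may
be `1`; the price is the local budget (the comparison is over `ℚ`, not over `ℚ_∞`).

CENSUS (EVIDENCE, `HOME/b2b-bsdres-x11a/g26/SELMER-COMPANION-CENSUS.md`): with cc-eng-2's
KO-certified partner table the budget `≤ p` is met for 11 of the 32 partner-bearing cells of the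
non-surjective leaf at `p = 5` (ten non-split `5S4`/`5Ns` cells with a rank-`0` good partner, `p`
the only lossy place; the split cell `84960a1` with the split partners `59040b1/c1`, lossy place
`59`) and for 28 RESIDUE cells of N7 at `p = 3` (all non-split `3Ns`/`3Nn`, rank-`0` partners good
at `3`); and `154880bb1 ↔ bg1`, `154880h1 ↔ m1` at `5` are pairs with `∏ ι_v = 1` (closing either
member of a pair closes the other).

## References

* [MazurRubin2004] B. Mazur, K. Rubin, *Kolyvagin systems*, Mem. AMS 799 (2004), §2.3.
* [Dokchitser2013ParityNotes] T. Dokchitser, *Notes on the parity conjecture* (2013), §2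
  (`Ш[p^∞] ≅ (ℚ_p/ℤ_p)^δ ×` square; the shape of `exists_selmerRank_eq_add`).
* [Cassels1962ArithmeticIV], [Tate1963DualityICM] (the pairing `hCT`); [Miller2011LMS] Def. 1.1;
  [SilvermanAEC2009] Thm. X.4.2; [SilvermanATAEC1994] Ch. V (Tate uniformisation `hU`, `hU2`);
  [KrausOesterle1992] Prop. 4 (certificate C1); [Mazur1977] III.§5 (no rational `p`-torsion).
* HOME/b2b-bsdres-x11a/REPORT-g26.md; class-closure/N7/CONG-certified-eng2.tsv (cc-eng-2).
-/

set_option autoImplicit false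

noncomputable section

open scoped Classical AddSubgroup

open WeierstrassCurve Literature.NumberTheory.EllipticCurves Literature.Algebra.Module
  Literature.NumberTheory.GaloisRepresentations Field NumberField IsDedekindDomain
  Literature.NumberTheory.EllipticCurves.Rank1Residual
  Literature.NumberTheory.EllipticCurves.Rank1Residual.Typed

namespace Summit.BirchSwinnertonDyer.Rank1Residual.X11a.SelmerCompanion

/-! ### Step 2: Cassels–Tate parity turns `#Sel^(p) ≤ p` into `Sel^(p) = 0` -/

section Parity

variable {K : Type} [Field K] [NumberField K]

/-- **Parity clean-up.** For an elliptic curve `E/K` of Mordell–Weil rank `0` with `E(K)[p] = 0` and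
`Ш(E/K)[p^∞]` finite, `#Sel^(p)(E/K) ≤ p` forces `#Sel^(p)(E/K) = 1`: by the descent count
`#Sel^(p) = p^{rank} · #E(K)[p] · #Ш[p]` (`natCard_selmerGroup_eq`) the Selmer group is `Ш[p]`, of
order `p^u`, and granted the Cassels–Tate pairing (`hCT`) `u = #E(K)[p]-exponent + corank + 2m = 2m`
(`exists_selmerRank_eq_add`, corank `0` by finiteness); `p^{2m} ≤ p` gives `m = 0`.
[cite: Dokchitser2013ParityNotes, §2] [cite: SilvermanAEC2009, Thm X.4.2] -/
theorem natCard_selmerGroup_eq_one_of_le (hCT : exists_casselsTate_pairing (K := K))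
    (W : WeierstrassCurve K) [W.IsElliptic] (p : ℕ) [hp : Fact p.Prime]
    (hrank : W.mordellWeilRank = 0) (hfin : Finite (AddCommGroup.primaryComponent W.sha p))
    (ht : Nat.card (W.toAffine.Point[(p : ℤ)]) = 1)
    (hle : Nat.card (W.selmerGroup (p : ℤ)) ≤ p) : Nat.card (W.selmerGroup (p : ℤ)) = 1 := by
  have hpP : p.Prime := hp.out
  have hp0 : (p : ℤ) ≠ 0 := Int.natCast_ne_zero.mpr hpP.ne_zero
  have hSel := W.natCard_selmerGroup_eq hpP.ne_zero
  rw [hrank, pow_zero, one_mul, ht, one_mul] at hSel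
  set T : AddSubgroup W.sha := AddCommGroup.primaryComponent W.sha p with hT
  haveI hShafin : Finite ((W.sha)[(p : ℤ)]) := W.finite_sha_torsionBy_holds (p : ℤ) hp0
  have hcard1 : Nat.card (W.sha ⊓ AddSubgroup.torsionBy W.galH1 (p : ℤ) : AddSubgroup W.galH1) =
      Nat.card ((W.sha)[(p : ℤ)]) := (natCard_torsionBy_addSubgroup W.sha (p : ℤ)).symm
  have hcard2 : Nat.card (T[(p : ℤ)]) = Nat.card ((W.sha)[(p : ℤ)]) := natCard_torsionBy_primaryComponent
  letI : Module (ZMod p) (T[(p : ℤ)]) := AddSubgroup.torsionBy.zmodModule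
  haveI hTfin : Finite (T[(p : ℤ)]) :=
    Nat.finite_of_card_ne_zero (by rw [hcard2]; exact Nat.card_pos.ne')
  set u : ℕ := Module.finrank (ZMod p) (T[(p : ℤ)]) with hu
  have hpu : p ^ u = Nat.card (T[(p : ℤ)]) := pow_finrank_eq_natCard _
  have hs : Nat.card (W.selmerGroup (p : ℤ)) = p ^ u := by rw [hSel, hcard1, ← hcard2, hpu]
  obtain ⟨m, hm⟩ := exists_selmerRank_eq_add hCT W p u 0 hs (by rw [pow_zero]; exact ht)
  have hco : W.selmerCorank p = 0 := by
    rw [W.selmerCorank_eq_mordellWeilRank_add_holds p, hrank,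
      (finite_primaryComponent_sha_iff_shaCorank_eq_zero W p).1 hfin]
  rw [hco] at hm
  have hu1 : u ≤ 1 := by
    rw [hs] at hle
    exact (Nat.pow_le_pow_iff_right hpP.one_lt).mp (by rw [pow_one]; exact hle)
  have hu0 : u = 0 := by omega
  rw [hs, hu0, pow_zero]

end Parity

/-! ### Steps 2–4 over `ℚ` -/

section OverQ

variable (W A : WeierstrassCurve ℚ) [W.IsElliptic] [A.IsElliptic] (p : ℕ) [Fact p.Prime]

omit [A.IsElliptic] in
/-- **`BSD(E,p)` at a rank-`0` pair with `E[p]` irreducible and `p ∤ #Ш_an`, from the bound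
`#Sel^(p)(E/ℚ) ≤ p`** (Gross–Zagier–Kolyvagin `hGZK`: rank `0` and `Ш` finite; Mazur: no rational
`p`-torsion; Cassels–Tate `hCT`: `natCard_selmerGroup_eq_one_of_le`; then
`bsdp_of_card_selmerGroup_eq_pow_analyticRank`). PUBLISHED inputs + a per-pair bound; not a class
theorem. [cite: Miller2011LMS, §1 and Def. 1.1] [cite: Mazur1977, Ch. III §5, p. 157] -/
theorem bsdp_of_natCard_selmerGroup_le (hGZK : rank_eq_analyticRank_of_analyticRank_le_one)
    (hCT : exists_casselsTate_pairing (K := ℚ)) (hr : W.analyticRank = 0) (hirr : Irr W p)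
    (hSha : X11a.ShaAnUnit W p) (hle : Nat.card (W.selmerGroup (p : ℤ)) ≤ p) : BSDp W p := by
  have hr1 : W.analyticRank ≤ 1 := by rw [hr]; exact zero_le_one
  obtain ⟨hrk, hfinSha⟩ := hGZK W hr1
  haveI := hfinSha
  have hrank : W.mordellWeilRank = 0 := by rw [hrk, hr]
  have hfin : Finite (AddCommGroup.primaryComponent W.sha p) := inferInstance
  -- (`convert` bridges the decidable-equality instance on `E(ℚ)` used by the general-`K` lemma)
  have h1 := natCard_selmerGroup_eq_one_of_le hCT W p hrank hfin
    (by convert natCard_torsionBy_eq_one_of_hasIrreducibleModPGaloisRep W p hirr) hle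
  obtain ⟨q, hq, hv⟩ := hSha
  exact bsdp_of_card_selmerGroup_eq_pow_analyticRank W p hGZK hr1 hq hv (by rw [h1, hr, pow_zero])

omit [W.IsElliptic] in
/-- **The partner's count: `BSD(A,p)`, `p ∤ #Ш(A/ℚ)_an` and `A[p]` irreducible give
`#Sel^(p)(A/ℚ) = p^{r_an(A)}`.** From Miller's `BSD(A,p)`: `rank A(ℚ) = r_an(A)`, `Ш(A)[p^∞]` is
finite and `ord_p #Ш(A)[p^∞] = ord_p #Ш(A)_an = 0` (the rational `#Ш_an` is unique), so `Ш(A)[p] = 0`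
(a non-trivial `p`-torsion subgroup of the finite `p`-primary part would make `p` divide its
order); then `#Sel^(p) = p^{rank} · #A(ℚ)[p] · #Ш(A)[p]` (`natCard_selmerGroup_eq`) with
`#A(ℚ)[p] = 1` (Mazur). [cite: Miller2011LMS, Def. 1.1 (arXiv:1010.2431 p. 3)]
[cite: SilvermanAEC2009, Thm X.4.2] [cite: Mazur1977, Ch. III §5, p. 157] -/
theorem natCard_selmerGroup_eq_pow_of_bsdp (hbsd : BSDp A p) (hSha : X11a.ShaAnUnit A p)
    (hirr : Irr A p) : Nat.card (A.selmerGroup (p : ℤ)) = p ^ A.analyticRank := by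
  have hp : p.Prime := Fact.out
  have hp0 : (p : ℤ) ≠ 0 := Int.natCast_ne_zero.mpr hp.ne_zero
  obtain ⟨hrk, hfin, q, hq, hv⟩ := hbsd
  obtain ⟨q', hq', hv'⟩ := hSha
  have hqq : q = q' := by
    have h : ((q : ℝ) : ℂ) = ((q' : ℝ) : ℂ) := by
      rw [Complex.ofReal_ratCast, Complex.ofReal_ratCast, ← hq, ← hq']
    exact_mod_cast h
  subst hqq
  haveI := hfin
  set T : AddSubgroup A.sha := AddCommGroup.primaryComponent A.sha p with hT
  -- `ord_p #Ш(A)[p^∞] = 0`, hence `p ∤ #Ш(A)[p^∞]`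
  have hval : padicValNat p (Nat.card T) = 0 := by
    have h := hv'.symm.trans hv
    exact_mod_cast h.symm
  have hndvd : ¬ p ∣ Nat.card T := by
    rcases padicValNat.eq_zero_iff.mp hval with h | h | h
    · exact absurd h hp.one_lt.ne'
    · exact absurd h Nat.card_pos.ne'
    · exact h
  -- hence `Ш(A)[p] = T[p]` is trivial
  haveI hShafin : Finite ((A.sha)[(p : ℤ)]) := A.finite_sha_torsionBy_holds (p : ℤ) hp0
  have hcard1 : Nat.card (A.sha ⊓ AddSubgroup.torsionBy A.galH1 (p : ℤ) : AddSubgroup A.galH1) =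
      Nat.card ((A.sha)[(p : ℤ)]) := (natCard_torsionBy_addSubgroup A.sha (p : ℤ)).symm
  have hcard2 : Nat.card (T[(p : ℤ)]) = Nat.card ((A.sha)[(p : ℤ)]) := natCard_torsionBy_primaryComponent
  letI : Module (ZMod p) (T[(p : ℤ)]) := AddSubgroup.torsionBy.zmodModule
  haveI hTfin : Finite (T[(p : ℤ)]) :=
    Nat.finite_of_card_ne_zero (by rw [hcard2]; exact Nat.card_pos.ne')
  have hpu : p ^ Module.finrank (ZMod p) (T[(p : ℤ)]) = Nat.card (T[(p : ℤ)]) :=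
    pow_finrank_eq_natCard _
  have hdvd : Nat.card (T[(p : ℤ)]) ∣ Nat.card T := AddSubgroup.card_addSubgroup_dvd_card _
  have hu0 : Module.finrank (ZMod p) (T[(p : ℤ)]) = 0 := by
    by_contra hne
    apply hndvd
    refine dvd_trans ?_ hdvd
    rw [← hpu]
    exact dvd_pow_self p hne
  have hShaOne : Nat.card (A.sha ⊓ AddSubgroup.torsionBy A.galH1 (p : ℤ) : AddSubgroup A.galH1) = 1 := by
    rw [hcard1, ← hcard2, ← hpu, hu0, pow_zero]
  have hSel := A.natCard_selmerGroup_eq hp.ne_zero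
  rw [hrk, hShaOne, mul_one] at hSel
  refine hSel.trans ?_
  conv_rhs => rw [← mul_one (p ^ A.analyticRank)]
  congr 1
  -- `#A(ℚ)[p] = 1` (`convert` bridges the decidable-equality instance on `A(ℚ)`)
  convert natCard_torsionBy_eq_one_of_hasIrreducibleModPGaloisRep A p hirr

end OverQ

/-! ### The per-pair route (steps 1–4) -/

section Route

variable (W A : WeierstrassCurve ℚ) [W.IsElliptic] [A.IsElliptic] (p : ℕ) [Fact p.Prime]

/-- **Route (3e), Selmer companion: `BSD(E,p)` at a rank-`0` pair with `E[p]` irreducible and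
`p ∤ #Ш(E/ℚ)_an` from a `p`-congruent partner `A` whose `p`-Selmer group fits the local budget.**
Data: an odd prime `p`; `e : A[p] ≃ E[p]` `Γ_ℚ`-equivariant (certificate C1); finite sets `T ⊆ S` of
finite places of `ℚ` with `E, A` good outside `S` and `S ⊇ {v ∣ p}`; every `v ∈ S \ T` of one of the
kinds (i) `v ∤ p`, `E(ℚ_v)[p] = 0`; (ii) both split multiplicative at `v`, `#A(ℚ_v)[p] ≤ p`; (iii)
both multiplicative at `v` with `γ(A) = r² γ(E)` in `ℚ_v` and `μ_p(ℚ_v) = 1`; and the budget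
`#Sel^(p)(A/ℚ) · ∏_{v ∈ T} #E(ℚ_v)[p] · #(ℤ_v/p) ≤ p`. Then `BSD(E,p)` (file I's count
`natCard_selmerGroup_le_of_congr_of_places` + `bsdp_of_natCard_selmerGroup_le`). Binders: GZK, the
Cassels–Tate pairing, Tate's uniformisation (twice) — all PUBLISHED; the rest is finite per-pair data.
Not a class theorem; nothing booked. [cite: MazurRubin2004, §2.3]
[cite: SilvermanATAEC1994, Ch. V Thm. 3.1, Lemma 5.2, Thm. 5.3, Cor. 5.4]
[cite: Miller2011LMS, §1 and Def. 1.1] -/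
theorem bsdp_of_selmerCompanion
    (hU : Silverman1994_thmV53_tateUniformisation.{0})
    (hU2 : Silverman1994_thmV53_corV54_tateUniformisation.{0})
    (hGZK : rank_eq_analyticRank_of_analyticRank_le_one)
    (hCT : exists_casselsTate_pairing (K := ℚ)) (hp2 : p ≠ 2)
    (hr : W.analyticRank = 0) (hirr : Irr W p) (hSha : X11a.ShaAnUnit W p)
    (e : geomTorsion A (p : ℤ) ≃+ geomTorsion W (p : ℤ))
    (he : ∀ (σ : absoluteGaloisGroup ℚ) (P : geomTorsion A (p : ℤ)), e (σ • P) = σ • e P)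
    (S T : Finset (HeightOneSpectrum (𝓞 ℚ))) (hTS : T ⊆ S)
    (hS : ∀ v : HeightOneSpectrum (𝓞 ℚ), v ∉ S →
      A.HasGoodReductionAt v ∧ W.HasGoodReductionAt v ∧ (p : 𝓞 ℚ) ∉ v.asIdeal)
    (hplaces : ∀ v ∈ S, v ∉ T →
      ((p : 𝓞 ℚ) ∉ v.asIdeal ∧ Nat.card (nsmulAddMonoidHom p :
          (W.baseChange (v.adicCompletion ℚ)).toAffine.Point →+ _).ker = 1) ∨
      (A.HasSplitMultiplicativeReductionAt v ∧ W.HasSplitMultiplicativeReductionAt v ∧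
        Nat.card (nsmulAddMonoidHom p :
          (A.baseChange (v.adicCompletion ℚ)).toAffine.Point →+ _).ker ≤ p) ∨
      (A.HasMultiplicativeReductionAt v ∧ W.HasMultiplicativeReductionAt v ∧
        (∃ r : v.adicCompletion ℚ, algebraMap ℚ (v.adicCompletion ℚ) (-(A.c₄ / A.c₆)) =
          r ^ 2 * algebraMap ℚ (v.adicCompletion ℚ) (-(W.c₄ / W.c₆))) ∧
        (∀ ζ : v.adicCompletion ℚ, ζ ^ p = 1 → ζ = 1)))
    (hbudget : Nat.card (A.selmerGroup (p : ℤ)) *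
        ∏ v ∈ T, (Nat.card (nsmulAddMonoidHom p :
            (W.baseChange (v.adicCompletion ℚ)).toAffine.Point →+ _).ker *
          Nat.card (v.adicCompletionIntegers ℚ ⧸
            Ideal.span {(p : v.adicCompletionIntegers ℚ)})) ≤ p) :
    BSDp W p := by
  -- transport along `θ = e⁻¹ : E[p] ≃ A[p]`
  have hθ : ∀ (σ : absoluteGaloisGroup ℚ) (Q : geomTorsion W (p : ℤ)),
      e.symm (σ • Q) = σ • e.symm Q := fun σ Q ↦ by
    apply e.injective
    rw [e.apply_symm_apply, he, e.apply_symm_apply]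
  have hle := natCard_selmerGroup_le_of_congr_of_places A W hU hU2 hp2 e.symm hθ S T hTS hS hplaces
  exact bsdp_of_natCard_selmerGroup_le W p hGZK hCT hr hirr hSha (hle.trans hbudget)

/-- **Route (3e), booking shape: `BSD(A,p) ⟹ BSD(E,p)` along a `p`-congruence through the Selmer
groups alone.** As `bsdp_of_selmerCompanion`, with the partner datum supplied by
`natCard_selmerGroup_eq_pow_of_bsdp`: `BSD(A,p)` (the partner's own closure at `p`),
`p ∤ #Ш(A/ℚ)_an`, and the budget `p^{r_an(A)} · ∏_{v ∈ T} #E(ℚ_v)[p] · #(ℤ_v/p) ≤ p`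
(irreducibility of `A[p]` is that of `E[p]`, transported along `e`). So a CLOSED rank-`0` partner
leaves room for one lossy place of cost `p` (the prime `p` itself when `E` is non-split
multiplicative there and `A` is good at `p`), a closed rank-`1` partner for none. NO main conjecture,
no `μ`-invariant, no Tamagawa or anomalous-prime condition, any odd `p` (also `p = 3`).
Per-pair evidence for a booking: C1 (Kraus–Oesterlé), the lane's closure of `(A, p)`, the local
kinds/torsion counts. Not a class theorem; nothing booked. [cite: MazurRubin2004, §2.3]
[cite: Miller2011LMS, §1 and Def. 1.1] [cite: KrausOesterle1992, Prop. 4 (shape of C1)] -/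
theorem bsdp_of_bsdp_partner_of_selmerCompanion
    (hU : Silverman1994_thmV53_tateUniformisation.{0})
    (hU2 : Silverman1994_thmV53_corV54_tateUniformisation.{0})
    (hGZK : rank_eq_analyticRank_of_analyticRank_le_one)
    (hCT : exists_casselsTate_pairing (K := ℚ)) (hp2 : p ≠ 2)
    (hr : W.analyticRank = 0) (hirr : Irr W p) (hSha : X11a.ShaAnUnit W p)
    (hbsdA : BSDp A p) (hShaA : X11a.ShaAnUnit A p)
    (e : geomTorsion A (p : ℤ) ≃+ geomTorsion W (p : ℤ))
    (he : ∀ (σ : absoluteGaloisGroup ℚ) (P : geomTorsion A (p : ℤ)), e (σ • P) = σ • e P)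
    (S T : Finset (HeightOneSpectrum (𝓞 ℚ))) (hTS : T ⊆ S)
    (hS : ∀ v : HeightOneSpectrum (𝓞 ℚ), v ∉ S →
      A.HasGoodReductionAt v ∧ W.HasGoodReductionAt v ∧ (p : 𝓞 ℚ) ∉ v.asIdeal)
    (hplaces : ∀ v ∈ S, v ∉ T →
      ((p : 𝓞 ℚ) ∉ v.asIdeal ∧ Nat.card (nsmulAddMonoidHom p :
          (W.baseChange (v.adicCompletion ℚ)).toAffine.Point →+ _).ker = 1) ∨
      (A.HasSplitMultiplicativeReductionAt v ∧ W.HasSplitMultiplicativeReductionAt v ∧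
        Nat.card (nsmulAddMonoidHom p :
          (A.baseChange (v.adicCompletion ℚ)).toAffine.Point →+ _).ker ≤ p) ∨
      (A.HasMultiplicativeReductionAt v ∧ W.HasMultiplicativeReductionAt v ∧
        (∃ r : v.adicCompletion ℚ, algebraMap ℚ (v.adicCompletion ℚ) (-(A.c₄ / A.c₆)) =
          r ^ 2 * algebraMap ℚ (v.adicCompletion ℚ) (-(W.c₄ / W.c₆))) ∧
        (∀ ζ : v.adicCompletion ℚ, ζ ^ p = 1 → ζ = 1)))
    (hbudget : p ^ A.analyticRank *
        ∏ v ∈ T, (Nat.card (nsmulAddMonoidHom p :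
            (W.baseChange (v.adicCompletion ℚ)).toAffine.Point →+ _).ker *
          Nat.card (v.adicCompletionIntegers ℚ ⧸
            Ideal.span {(p : v.adicCompletionIntegers ℚ)})) ≤ p) :
    BSDp W p := by
  have hirrA : Irr A p :=
    GreenbergVatsal2000.hasIrreducibleModPGaloisRep_of_torsionIso e.symm (fun σ Q ↦ by
      apply e.injective
      rw [e.apply_symm_apply, he, e.apply_symm_apply]) hirr
  have hA := natCard_selmerGroup_eq_pow_of_bsdp A p hbsdA hShaA hirrA
  exact bsdp_of_selmerCompanion W A p hU hU2 hGZK hCT hp2 hr hirr hSha e he S T hTS hS hplaces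
    (by rw [hA]; exact hbudget)

variable [W.IsGloballyMinimal]

/-- **Route (3e) on class X11a** (`ClassX11a W p`: `r = 0`, `p` odd, `p ‖ N`, `E[p]` irreducible, no
(ram) prime — any odd `p`, the `p = 3` sub-cell included) with `p ∤ #Ш_an`: the booking shape
`bsdp_of_bsdp_partner_of_selmerCompanion` with `r_an(E) = 0`, `p ≠ 2` and `Irr` read off the class
predicate. Not a class theorem; nothing booked. [cite: MazurRubin2004, §2.3]
[cite: Miller2011LMS, §1 and Def. 1.1] -/
theorem bsdp_of_bsdp_partner_of_selmerCompanion_of_classX11a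
    (hU : Silverman1994_thmV53_tateUniformisation.{0})
    (hU2 : Silverman1994_thmV53_corV54_tateUniformisation.{0})
    (hGZK : rank_eq_analyticRank_of_analyticRank_le_one)
    (hCT : exists_casselsTate_pairing (K := ℚ))
    (hX : ClassX11a W p) (hSha : X11a.ShaAnUnit W p)
    (hbsdA : BSDp A p) (hShaA : X11a.ShaAnUnit A p)
    (e : geomTorsion A (p : ℤ) ≃+ geomTorsion W (p : ℤ))
    (he : ∀ (σ : absoluteGaloisGroup ℚ) (P : geomTorsion A (p : ℤ)), e (σ • P) = σ • e P)
    (S T : Finset (HeightOneSpectrum (𝓞 ℚ))) (hTS : T ⊆ S)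
    (hS : ∀ v : HeightOneSpectrum (𝓞 ℚ), v ∉ S →
      A.HasGoodReductionAt v ∧ W.HasGoodReductionAt v ∧ (p : 𝓞 ℚ) ∉ v.asIdeal)
    (hplaces : ∀ v ∈ S, v ∉ T →
      ((p : 𝓞 ℚ) ∉ v.asIdeal ∧ Nat.card (nsmulAddMonoidHom p :
          (W.baseChange (v.adicCompletion ℚ)).toAffine.Point →+ _).ker = 1) ∨
      (A.HasSplitMultiplicativeReductionAt v ∧ W.HasSplitMultiplicativeReductionAt v ∧
        Nat.card (nsmulAddMonoidHom p :
          (A.baseChange (v.adicCompletion ℚ)).toAffine.Point →+ _).ker ≤ p) ∨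
      (A.HasMultiplicativeReductionAt v ∧ W.HasMultiplicativeReductionAt v ∧
        (∃ r : v.adicCompletion ℚ, algebraMap ℚ (v.adicCompletion ℚ) (-(A.c₄ / A.c₆)) =
          r ^ 2 * algebraMap ℚ (v.adicCompletion ℚ) (-(W.c₄ / W.c₆))) ∧
        (∀ ζ : v.adicCompletion ℚ, ζ ^ p = 1 → ζ = 1)))
    (hbudget : p ^ A.analyticRank *
        ∏ v ∈ T, (Nat.card (nsmulAddMonoidHom p :
            (W.baseChange (v.adicCompletion ℚ)).toAffine.Point →+ _).ker *
          Nat.card (v.adicCompletionIntegers ℚ ⧸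
            Ideal.span {(p : v.adicCompletionIntegers ℚ)})) ≤ p) :
    BSDp W p :=
  bsdp_of_bsdp_partner_of_selmerCompanion W A p hU hU2 hGZK hCT hX.2.1 hX.1 hX.2.2.2.1 hSha hbsdA
    hShaA e he S T hTS hS hplaces hbudget

end Route

end Summit.BirchSwinnertonDyer.Rank1Residual.X11a.SelmerCompanion

end
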